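import Summits.Ventures.PercRepro.RankDistEars
import Summits.Ventures.PercRepro.RankDistEarsLevelSum

/-!
# PercRepro — `C₄ + ears`: THE PATTERN OF A SET, ITS RANK, THE BOTTOM SETS AND THE UP-SET (p9, gen 24)

A set `A ⊆ E` of `C₄ + ears` (`RankDistEars`) is determined by its pattern `(patX A, patG A)` — the host edges it
contains and, for every ear, the edges of the ear it contains; `earsOf X g` is the inverse. In these terms
(`K = Σ_j k j` ears in all, tight layer `(p, q) = (K + 3, K + 1)`):
* `rk_ears_pat`: `ρ(A) = #{i : g i ≠ ∅} + min(#(X ∪ host(full g)), 3)`;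
* the pattern of the complement (`patX_compl`, `patG_compl`) and the counts of missed / full ears host by host
  (`card_hit_add_card_miss`, `card_missSet_eq_sum`, `image_fst_missSet`, `card_missSet_of_le_one`, …);
the bottom sets and the up-set follow in `RankDistEarsBottom`. Nothing here moves any window of the crux.
-/

namespace PercRepro.RankDist

open Set Finset _root_.Matroid PercRepro.ThmH

variable {k : Fin 4 → ℕ}

/-! ## The pattern maps -/

/-- Membership in `patX`. -/
lemma mem_patX {A : Set (Gr k)} {j : Fin 4} : j ∈ patX k A ↔ Sum.inl j ∈ A := by
  unfold patX; simp

/-- Membership in `patG`. -/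
lemma mem_patG {A : Set (Gr k)} {i : Ear k} {b : Bool} : b ∈ patG k A i ↔ Sum.inr (i, b) ∈ A := by
  unfold patG; simp

/-- Membership in `earsOf`, host edges. -/
lemma inl_mem_earsOf {X : Finset (Fin 4)} {g : Ear k → Finset Bool} {j : Fin 4} :
    Sum.inl j ∈ earsOf k X g ↔ j ∈ X := Iff.rfl

/-- Membership in `earsOf`, ear edges. -/
lemma inr_mem_earsOf {X : Finset (Fin 4)} {g : Ear k → Finset Bool} {i : Ear k} {b : Bool} :
    Sum.inr (i, b) ∈ earsOf k X g ↔ b ∈ g i := Iff.rfl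

/-- The pattern of `earsOf X g` is `X`. -/
lemma patX_earsOf (X : Finset (Fin 4)) (g : Ear k → Finset Bool) : patX k (earsOf k X g) = X := by
  ext j; rw [mem_patX, inl_mem_earsOf]

/-- The pattern of `earsOf X g` is `g`. -/
lemma patG_earsOf (X : Finset (Fin 4)) (g : Ear k → Finset Bool) : patG k (earsOf k X g) = g := by
  funext i; ext b; rw [mem_patG, inr_mem_earsOf]

/-- A set is recovered from its pattern. -/
lemma earsOf_pat (A : Set (Gr k)) : earsOf k (patX k A) (patG k A) = A := by
  ext x
  rcases x with j | ⟨i, b⟩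
  · rw [inl_mem_earsOf, mem_patX]
  · rw [inr_mem_earsOf, mem_patG]

/-- The host edges of `A` as a set are the coercion of `patX A`. -/
lemma earsX_eq_coe_patX (A : Set (Gr k)) : earsX k A = ↑(patX k A) := by
  ext j; rw [Finset.mem_coe, mem_patX]; rfl

/-- The hit ears are those with a nonempty pattern. -/
lemma earsHit_eq_coe (A : Set (Gr k)) :
    earsHit k A = ↑(Finset.univ.filter (fun i : Ear k => patG k A i ≠ ∅)) := by
  ext i
  rw [Finset.mem_coe, Finset.mem_filter]
  simp only [Finset.mem_univ, true_and, earsHit, Set.mem_setOf_eq, ← Finset.nonempty_iff_ne_empty]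
  constructor
  · rintro (h | h)
    · exact ⟨true, mem_patG.2 h⟩
    · exact ⟨false, mem_patG.2 h⟩
  · rintro ⟨b, hb⟩
    rw [mem_patG] at hb
    cases b
    · exact Or.inr hb
    · exact Or.inl hb

/-- The full ears are those with the full pattern. -/
lemma earsFull_eq_coe (A : Set (Gr k)) :
    earsFull k A = ↑(Finset.univ.filter (fun i : Ear k => patG k A i = Finset.univ)) := by
  ext i
  rw [Finset.mem_coe, Finset.mem_filter]
  simp only [Finset.mem_univ, true_and, earsFull, Set.mem_setOf_eq]
  constructor
  · rintro ⟨h1, h2⟩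
    ext b
    simp only [Finset.mem_univ, iff_true]
    rw [mem_patG]
    cases b
    · exact h2
    · exact h1
  · intro h
    exact ⟨mem_patG.1 (by rw [h]; exact Finset.mem_univ _), mem_patG.1 (by rw [h]; exact Finset.mem_univ _)⟩

/-- The effective core edges, as a finset. -/
lemma earsXeff_eq_coe (A : Set (Gr k)) :
    earsXeff k A = ↑(patX k A ∪ (Finset.univ.filter (fun i : Ear k => patG k A i = Finset.univ)).image Sigma.fst) := by
  rw [earsXeff, earsX_eq_coe_patX, earsFull_eq_coe, Finset.coe_union, Finset.coe_image]

/-- **The rank in pattern form**: `ρ(A) = #{i : g i ≠ ∅} + min(#(X ∪ host(full g)), 3)`. -/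
theorem rk_ears_pat (A : Set (Gr k)) :
    rk (ears k) A = (Finset.univ.filter (fun i : Ear k => patG k A i ≠ ∅)).card
      + min (patX k A ∪ (Finset.univ.filter (fun i : Ear k => patG k A i = Finset.univ)).image Sigma.fst).card 3 := by
  rw [rk_ears, earsHit_eq_coe, earsXeff_eq_coe, Set.ncard_coe_finset, Set.ncard_coe_finset]

/-! ## The complement of a set -/

/-- The host edges of the complement. -/
lemma patX_compl (A : Set (Gr k)) : patX k (Set.univ \ A) = (patX k A)ᶜ := by
  ext j; rw [mem_patX, Finset.mem_compl, mem_patX]; simp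

/-- The ear pattern of the complement. -/
lemma patG_compl (A : Set (Gr k)) (i : Ear k) : patG k (Set.univ \ A) i = (patG k A i)ᶜ := by
  ext b; rw [mem_patG, Finset.mem_compl, mem_patG]; simp

/-- The complement of a pattern is nonempty iff the pattern is not full. -/
lemma compl_ne_empty_iff (s : Finset Bool) : sᶜ ≠ ∅ ↔ s ≠ Finset.univ := by
  rw [Ne, Finset.compl_eq_empty_iff]

/-- The complement of a pattern is full iff the pattern is empty. -/
lemma compl_eq_univ_iff (s : Finset Bool) : sᶜ = Finset.univ ↔ s = ∅ := by
  rw [Finset.compl_eq_univ_iff]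

/-! ## Counting ears by host -/

variable (k)

/-- The missed ears, as a finset. -/
def missSet (g : Ear k → Finset Bool) : Finset (Ear k) := Finset.univ.filter (fun i => g i = ∅)

/-- The full ears, as a finset. -/
def fullSet (g : Ear k → Finset Bool) : Finset (Ear k) := Finset.univ.filter (fun i => g i = Finset.univ)

/-- The total number of ears is `Σ_j k j`. -/
lemma card_ear : Fintype.card (Ear k) = ∑ j, k j := by
  rw [Fintype.card_sigma]; simp only [Fintype.card_fin]

variable {k}

/-- `#hit + #miss = K`. -/
lemma card_hit_add_card_miss (g : Ear k → Finset Bool) :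
    (Finset.univ.filter (fun i => g i ≠ ∅)).card + (missSet k g).card = ∑ j, k j := by
  rw [missSet, ← card_ear k, ← Finset.card_univ]
  have := Finset.card_filter_add_card_filter_not (s := (Finset.univ : Finset (Ear k))) (fun i => g i = ∅)
  rw [add_comm] at this
  simpa only [ne_eq] using this

/-- The missed ears counted host by host. -/
lemma card_missSet_eq_sum (g : Ear k → Finset Bool) : (missSet k g).card = ∑ j, hostMiss k g j := by
  rw [Finset.card_eq_sum_card_fiberwise (f := Sigma.fst) (t := Finset.univ) (fun _ _ => Finset.mem_univ _)]
  refine Finset.sum_congr rfl (fun j _ => ?_)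
  unfold hostMiss missSet
  rw [Finset.filter_filter]
  congr 1
  ext i
  simp only [Finset.mem_filter, Finset.mem_univ, true_and]
  exact and_comm

/-- The hosts of the missed ears are the hosts with a missed ear. -/
lemma image_fst_missSet (g : Ear k → Finset Bool) :
    (missSet k g).image Sigma.fst = Finset.univ.filter (fun j => 0 < hostMiss k g j) := by
  ext j
  simp only [Finset.mem_image, missSet, Finset.mem_filter, Finset.mem_univ, true_and, hostMiss,
    Finset.card_pos, Finset.Nonempty]
  constructor
  · rintro ⟨i, hi, rfl⟩; exact ⟨i, rfl, hi⟩
  · rintro ⟨i, hij, hi⟩; exact ⟨i, hi, hij⟩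

/-- The hosts of the full ears are the hosts with a full ear. -/
lemma image_fst_fullSet (g : Ear k → Finset Bool) :
    (fullSet k g).image Sigma.fst = typeF (hostType k g) := by
  ext j
  simp only [Finset.mem_image, fullSet, Finset.mem_filter, Finset.mem_univ, true_and, typeF, hostType,
    hostFull, decide_eq_true_eq]
  constructor
  · rintro ⟨i, hi, rfl⟩; exact ⟨i, rfl, hi⟩
  · rintro ⟨i, hij, hi⟩; exact ⟨i, hi, hij⟩

/-- The hosts with exactly one missed ear, read off the host type. -/
lemma typeM_hostType (g : Ear k → Finset Bool) :
    typeM (hostType k g) = Finset.univ.filter (fun j => hostMiss k g j = 1) := by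
  ext j; simp [typeM, hostType]

/-- With at most one missed ear per host, the hosts with a missed ear are those with exactly one. -/
lemma image_fst_missSet_of_le_one (g : Ear k → Finset Bool) (h : ∀ j, hostMiss k g j ≤ 1) :
    (missSet k g).image Sigma.fst = typeM (hostType k g) := by
  rw [image_fst_missSet, typeM_hostType]
  ext j
  simp only [Finset.mem_filter, Finset.mem_univ, true_and]
  have := h j
  omega

/-- With at most one missed ear per host, the host map is injective on the missed ears. -/
lemma card_image_fst_missSet_of_le_one (g : Ear k → Finset Bool) (h : ∀ j, hostMiss k g j ≤ 1) :
    ((missSet k g).image Sigma.fst).card = (missSet k g).card := by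
  apply Finset.card_image_of_injOn
  intro i hi i' hi' hii
  rw [Finset.mem_coe, missSet, Finset.mem_filter] at hi hi'
  by_contra hne
  have hsub : {i, i'} ⊆ Finset.univ.filter (fun x : Ear k => x.1 = i.1 ∧ g x = ∅) := by
    intro x hx
    rw [Finset.mem_insert, Finset.mem_singleton] at hx
    rw [Finset.mem_filter]
    rcases hx with rfl | rfl
    · exact ⟨Finset.mem_univ _, rfl, hi.2⟩
    · exact ⟨Finset.mem_univ _, hii.symm, hi'.2⟩
  have h2 : 2 ≤ hostMiss k g i.1 := by
    unfold hostMiss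
    rw [← Finset.card_pair hne]
    convert Finset.card_le_card hsub using 2
  have := h i.1
  omega

/-- The number of missed ears is the number of hosts with exactly one, when no host misses two. -/
lemma card_missSet_of_le_one (g : Ear k → Finset Bool) (h : ∀ j, hostMiss k g j ≤ 1) :
    (missSet k g).card = (typeM (hostType k g)).card := by
  rw [← image_fst_missSet_of_le_one g h, card_image_fst_missSet_of_le_one g h]

/-- `#(image fst miss) ≤ #miss`. -/
lemma card_image_fst_missSet_le (g : Ear k → Finset Bool) :
    ((missSet k g).image Sigma.fst).card ≤ (missSet k g).card := Finset.card_image_le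

/-- A host with a missed ear has exactly one when no host misses two. -/
lemma hostMiss_eq_one_of_pos (g : Ear k → Finset Bool) (h : ∀ j, hostMiss k g j ≤ 1) {j : Fin 4}
    (hj : 0 < hostMiss k g j) : hostMiss k g j = 1 := by
  have := h j; omega

end PercRepro.RankDist
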